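import Summits.CriticalPhenomena.PercolationContinuityZ3.Theorems.SahiAEOpenBand

/-!
# Open bands in every dimension: a full measurable sublattice of the cube is almost an open band

Support file of the Sahi cell (`prim-sahi`, typer seat, generation 25; `--supports stmt-CriticalPhenomena-4575`).
Two small definitions (`rectCyl`, `bandHull`), theorems otherwise; no named facts, no sorries.

Support step of the structure theorem for densities with zeros in every dimension (the planar case is
`Plane.exists_isBand_ae_eq` of `SahiAEBandSupport.lean`, generation 24).  Let `L ⊆ (0,1)^ι` be a measurable
sublattice which is FULL: for every direction `i` and almost every height `s ∈ (0,1)` the hyperplane `{zᵢ = s}` meets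
`L`.  Then `L` coincides almost everywhere with the OPEN BAND (`IsOpenBand`)

  `bandHull L = (0,1)^ι ∩ ⋂_{i ≠ j} rectCyl L i j`,
  `rectCyl L i j = {w | ∃ x, y ∈ L, xᵢ < wᵢ < yᵢ, yⱼ < wⱼ < xⱼ}`

(`exists_isOpenBand_ae_eq`).  Ingredients: the cylinders over the planar rectangle unions are open bands
(`isOpenBand_rectCyl`, lattice algebra as in the plane); `L ⊆ᵐ bandHull L` because the points of `L` outside a
cylinder have no point of `L` strictly upper-left or none strictly lower-right in the `(i, j)`-picture, two
measurable sets which are COMONOTONE in `(i, j)` and hence null (`volume_eq_zero_of_comonotone`: a measurable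
`E ⊆ ℝ^ι` with `zᵢ < z'ᵢ ⟹ zⱼ ≤ z'ⱼ` on `E × E` is null — Fubini along the dummy coordinate `i`
(`lintegral_lintegral_update`): all but countably many hyperplane sections lie in a single `j`-hyperplane);
`bandHull L ⊆ᵐ L` by fullness and TWO-DECOMPOSABILITY of sublattices of `ℝ^ι` (Topkis): from points of `L` on the
hyperplanes through `w` and the rectangle witnesses one builds `z^{ij} ∈ L` with `z^{ij}ᵢ = wᵢ`, `z^{ij}ⱼ = wⱼ`
(`(x ⊔ uⁱ) ⊓ (y ⊔ uʲ)`), and `w = ⋁ᵢ ⋀_{j ≠ i} z^{ij}`.  Requires `|ι| ≥ 2`.  No sorries, no new axioms.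
-/

noncomputable section

namespace Summit.CriticalPhenomena.PercolationContinuityZ3.Theorems.SahiAEFourFunctions

open MeasureTheory Set Filter Topology Function Metric
open scoped ENNReal NNReal

variable {ι : Type*} [Fintype ι] [DecidableEq ι]

/-! ### Comonotone sets are null -/

/-- **A measurable set which is comonotone in two coordinates is Lebesgue-null.**  Comonotone in `(i, j)`:
`zᵢ < z'ᵢ ⟹ zⱼ ≤ z'ⱼ` for `z, z' ∈ E`.  (All but countably many sections `{zᵢ = t}` of `E` lie in a hyperplane
`{zⱼ = a}`; Fubini along the dummy coordinate `i`.) [this work] -/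
theorem volume_eq_zero_of_comonotone {i j : ι} (hij : i ≠ j) {E : Set (ι → ℝ)} (hE : MeasurableSet E)
    (hco : ∀ z ∈ E, ∀ z' ∈ E, z i < z' i → z j ≤ z' j) : volume E = 0 := by
  classical
  -- the pulled-back set along `(c, t) ↦ (c; i := t)`
  set Et : Set ((ι → ℝ) × ℝ) := {q | update q.1 i q.2 ∈ E} with hEt
  have mEt : MeasurableSet Et := measurable_update' hE
  -- first computation: `⊤ · volume E`
  have h1 : ((volume : Measure (ι → ℝ)).prod (volume : Measure ℝ)) Et = ⊤ * volume E := by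
    rw [Measure.prod_apply mEt]
    have e : ∀ x : ι → ℝ, (volume : Measure ℝ) (Prod.mk x ⁻¹' Et) =
        ∫⁻ r, E.indicator 1 (update x i r) ∂(volume : Measure ℝ) := by
      intro x
      have ex : Prod.mk x ⁻¹' Et = (update x i) ⁻¹' E := rfl
      rw [ex, ← lintegral_indicator_one ((measurable_update x) hE)]
      rfl
    simp_rw [e]
    rw [SahiAESeparableTilt.lintegral_lintegral_update i (measurable_one.indicator hE), lintegral_indicator_one hE]
  -- second computation: integrate the sections over the height
  have h2 : ((volume : Measure (ι → ℝ)).prod (volume : Measure ℝ)) Et =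
      ∫⁻ t, (volume : Measure (ι → ℝ)) {c | update c i t ∈ E} ∂(volume : Measure ℝ) := by
    rw [Measure.prod_apply_symm mEt]; rfl
  -- fat heights: sections with two different `j`-coordinates
  set T : Set ℝ := {t | ∃ c c' : ι → ℝ, update c i t ∈ E ∧ update c' i t ∈ E ∧ c j < c' j} with hT
  have hthin : ∀ t, t ∉ T → (volume : Measure (ι → ℝ)) {c | update c i t ∈ E} = 0 := by
    intro t ht
    rcases Set.eq_empty_or_nonempty {c : ι → ℝ | update c i t ∈ E} with h0 | ⟨c₀, hc₀⟩
    · rw [h0, measure_empty]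
    · have hsub : {c : ι → ℝ | update c i t ∈ E} ⊆ (fun c : ι → ℝ => c j) ⁻¹' {c₀ j} := by
        intro c hc
        simp only [Set.mem_preimage, Set.mem_singleton_iff]
        by_contra hne
        rcases lt_or_gt_of_ne hne with h | h
        · exact ht ⟨c, c₀, hc, hc₀, h⟩
        · exact ht ⟨c₀, c, hc₀, hc, h⟩
      exact measure_mono_null hsub
        ((SahiAESeparableTilt.quasiMeasurePreserving_eval (ι := ι) j).preimage_null Real.volume_singleton)
  have hTc : T.Countable := by
    -- a strictly increasing choice of rationals on `T`
    have hr : ∀ t : T, ∃ r : ℚ, ∃ c c' : ι → ℝ, update c i (t : ℝ) ∈ E ∧ update c' i (t : ℝ) ∈ E ∧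
        c j < r ∧ (r : ℝ) < c' j := fun ⟨t, c, c', hc, hc', hlt⟩ => by
      obtain ⟨r, hr1, hr2⟩ := exists_rat_btwn hlt
      exact ⟨r, c, c', hc, hc', hr1, hr2⟩
    choose r c c' hc hc' hr1 hr2 using hr
    have hmono : ∀ t t' : T, (t : ℝ) < t' → r t < r t' := fun t t' htt' => by
      have h := hco _ (hc' t) _ (hc t') (by simpa using htt')
      simp only [update_of_ne (Ne.symm hij)] at h
      have : (r t : ℝ) < r t' := (hr2 t).trans_le (h.trans (hr1 t').le)
      exact_mod_cast this
    have hinj : Function.Injective r := fun t t' h => by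
      by_contra hne
      rcases lt_or_gt_of_ne (Subtype.coe_injective.ne hne) with hlt | hlt
      · exact (hmono t t' hlt).ne h
      · exact (hmono t' t hlt).ne h.symm
    exact Set.countable_coe_iff.1 hinj.countable
  have h3 : ∫⁻ t, (volume : Measure (ι → ℝ)) {c | update c i t ∈ E} ∂(volume : Measure ℝ) = 0 := by
    have hae : ∀ᵐ t ∂(volume : Measure ℝ), t ∉ T := by
      rw [ae_iff]; simpa only [not_not, Set.setOf_mem_eq] using hTc.measure_zero (volume : Measure ℝ)
    rw [lintegral_congr_ae (hae.mono fun t ht => hthin t ht), lintegral_zero]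
  have h4 : ⊤ * volume E = 0 := by rw [← h1, h2, h3]
  simpa using h4

/-! ### The rectangle cylinders -/

omit [Fintype ι] [DecidableEq ι] in
/-- **The rectangle cylinder** of `L` in the coordinates `(i, j)`: the points `w` with a point of `L` strictly
upper-left and a point of `L` strictly lower-right in the `(i, j)`-picture. [this work] -/
def rectCyl (L : Set (ι → ℝ)) (i j : ι) : Set (ι → ℝ) :=
  {w | ∃ x ∈ L, ∃ y ∈ L, x i < w i ∧ w i < y i ∧ y j < w j ∧ w j < x j}

omit [Fintype ι] in
/-- **The rectangle cylinders of a sublattice are open bands.** [this work] -/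
theorem isOpenBand_rectCyl {L : Set (ι → ℝ)} (hinf : ∀ x ∈ L, ∀ y ∈ L, x ⊓ y ∈ L)
    (hsup : ∀ x ∈ L, ∀ y ∈ L, x ⊔ y ∈ L) {i j : ι} (hij : i ≠ j) : IsOpenBand (rectCyl L i j) := by
  refine ⟨?_, ?_, ?_, fun w k => ⟨?_⟩⟩
  · have e : rectCyl L i j = ⋃ x ∈ L, ⋃ y ∈ L, {w : ι → ℝ | x i < w i ∧ w i < y i ∧ y j < w j ∧ w j < x j} := by
      ext w; simp only [rectCyl, Set.mem_setOf_eq, Set.mem_iUnion, exists_prop]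
    rw [e]
    refine isOpen_biUnion fun x _ => isOpen_biUnion fun y _ => ?_
    have ci : Continuous fun w : ι → ℝ => w i := continuous_apply i
    have cj : Continuous fun w : ι → ℝ => w j := continuous_apply j
    have e2 : {w : ι → ℝ | x i < w i ∧ w i < y i ∧ y j < w j ∧ w j < x j} =
        ({w | x i < w i} ∩ {w | w i < y i}) ∩ ({w | y j < w j} ∩ {w | w j < x j}) := by
      ext w; simp only [Set.mem_inter_iff, Set.mem_setOf_eq, and_assoc]
    rw [e2]
    exact ((isOpen_lt continuous_const ci).inter (isOpen_lt ci continuous_const)).inter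
      ((isOpen_lt continuous_const cj).inter (isOpen_lt cj continuous_const))
  · rintro w ⟨x, hx, y, hy, h1, h2, h3, h4⟩ w' ⟨x', hx', y', hy', h1', h2', h3', h4'⟩
    refine ⟨x ⊓ x', hinf _ hx _ hx', y ⊓ y', hinf _ hy _ hy', ?_, ?_, ?_, ?_⟩ <;> simp only [Pi.inf_apply]
    · exact min_lt_min h1 h1'
    · exact min_lt_min h2 h2'
    · exact min_lt_min h3 h3'
    · exact min_lt_min h4 h4'
  · rintro w ⟨x, hx, y, hy, h1, h2, h3, h4⟩ w' ⟨x', hx', y', hy', h1', h2', h3', h4'⟩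
    refine ⟨x ⊔ x', hsup _ hx _ hx', y ⊔ y', hsup _ hy _ hy', ?_, ?_, ?_, ?_⟩ <;> simp only [Pi.sup_apply]
    · exact max_lt_max h1 h1'
    · exact max_lt_max h2 h2'
    · exact max_lt_max h3 h3'
    · exact max_lt_max h4 h4'
  · rintro s ⟨x, hx, y, hy, h1, h2, h3, h4⟩ u ⟨x', hx', y', hy', h1', h2', h3', h4'⟩ t ht
    simp only [Set.mem_setOf_eq] at *
    by_cases hki : k = i
    · subst hki
      rw [update_self] at h1 h2 h1' h2'
      rw [update_of_ne (Ne.symm hij)] at h3 h4 h3' h4'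
      refine ⟨x, hx, y', hy', ?_, ?_, ?_, ?_⟩
      · rw [update_self]; exact h1.trans_le ht.1
      · rw [update_self]; exact ht.2.trans_lt h2'
      · rw [update_of_ne (Ne.symm hij)]; exact h3'
      · rw [update_of_ne (Ne.symm hij)]; exact h4
    · by_cases hkj : k = j
      · subst hkj
        rw [update_self] at h3 h4 h3' h4'
        rw [update_of_ne hij] at h1 h2 h1' h2'
        refine ⟨x', hx', y, hy, ?_, ?_, ?_, ?_⟩
        · rw [update_of_ne hij]; exact h1'
        · rw [update_of_ne hij]; exact h2
        · rw [update_self]; exact h3.trans_le ht.1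
        · rw [update_self]; exact ht.2.trans_lt h4'
      · refine ⟨x, hx, y, hy, ?_, ?_, ?_, ?_⟩
        · rw [update_of_ne (Ne.symm hki)] at h1 ⊢; exact h1
        · rw [update_of_ne (Ne.symm hki)] at h2 ⊢; exact h2
        · rw [update_of_ne (Ne.symm hkj)] at h3 ⊢; exact h3
        · rw [update_of_ne (Ne.symm hkj)] at h4 ⊢; exact h4

omit [Fintype ι] in
/-- Intersections of open bands are open bands. [folklore] -/
theorem IsOpenBand.inter {U V : Set (ι → ℝ)} (hU : IsOpenBand U) (hV : IsOpenBand V) : IsOpenBand (U ∩ V) :=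
  ⟨hU.isOpen.inter hV.isOpen, fun x hx y hy => ⟨hU.inf_mem x hx.1 y hy.1, hV.inf_mem x hx.2 y hy.2⟩,
    fun x hx y hy => ⟨hU.sup_mem x hx.1 y hy.1, hV.sup_mem x hx.2 y hy.2⟩,
    fun x i => (hU.ordConnected x i).inter (hV.ordConnected x i)⟩

omit [Fintype ι] in
/-- Finite intersections of open bands inside an open band are open bands. [folklore] -/
theorem IsOpenBand.biInter_finset {α : Type*} {U : Set (ι → ℝ)} (hU : IsOpenBand U) {V : α → Set (ι → ℝ)}
    (s : Finset α) (hV : ∀ a ∈ s, IsOpenBand (V a)) : IsOpenBand (U ∩ ⋂ a ∈ s, V a) := by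
  classical
  induction s using Finset.induction_on with
  | empty => simpa using hU
  | @insert a s ha ih =>
    have e : (U ∩ ⋂ b ∈ insert a s, V b) = (U ∩ ⋂ b ∈ s, V b) ∩ V a := by
      ext w; simp only [Finset.mem_insert, Set.mem_inter_iff, Set.mem_iInter]
      constructor
      · rintro ⟨hw, h⟩; exact ⟨⟨hw, fun b hb => h b (Or.inr hb)⟩, h a (Or.inl rfl)⟩
      · rintro ⟨⟨hw, h⟩, ha'⟩ ; refine ⟨hw, fun b hb => ?_⟩
        rcases hb with rfl | hb
        · exact ha'
        · exact h b hb
    rw [e]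
    exact (ih fun b hb => hV b (Finset.mem_insert_of_mem hb)).inter (hV a (Finset.mem_insert_self a s))

/-- The open unit cube is an open band. [folklore] -/
theorem isOpenBand_cube : IsOpenBand (Set.pi univ fun _ : ι => Ioo (0 : ℝ) 1) := by
  refine ⟨isOpen_set_pi Set.finite_univ fun _ _ => isOpen_Ioo, fun x hx y hy => ?_, fun x hx y hy => ?_,
    fun x i => ⟨fun s hs u hu t ht => ?_⟩⟩
  · rw [Set.mem_univ_pi] at hx hy ⊢
    intro k; simp only [Pi.inf_apply]
    exact ⟨lt_min (hx k).1 (hy k).1, (min_le_left _ _).trans_lt (hx k).2⟩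
  · rw [Set.mem_univ_pi] at hx hy ⊢
    intro k; simp only [Pi.sup_apply]
    exact ⟨(hx k).1.trans_le (le_max_left _ _), max_lt (hx k).2 (hy k).2⟩
  · simp only [Set.mem_setOf_eq, Set.mem_univ_pi] at hs hu ⊢
    intro k
    by_cases hk : k = i
    · subst hk; rw [update_self]
      have h1 := hs k; have h2 := hu k; rw [update_self] at h1 h2
      exact ⟨h1.1.trans_le ht.1, ht.2.trans_lt h2.2⟩
    · rw [update_of_ne hk]; have h1 := hs k; rw [update_of_ne hk] at h1; exact h1

/-! ### The band hull of a sublattice of the cube -/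

/-- **The band hull** of `L`: the points of the open unit cube lying in every rectangle cylinder of `L`. [this work] -/
def bandHull (L : Set (ι → ℝ)) : Set (ι → ℝ) :=
  (Set.pi univ fun _ : ι => Ioo (0 : ℝ) 1) ∩ ⋂ p ∈ (Finset.univ.filter fun p : ι × ι => p.1 ≠ p.2), rectCyl L p.1 p.2

/-- Membership in the band hull. [folklore] -/
theorem mem_bandHull {L : Set (ι → ℝ)} {w : ι → ℝ} :
    w ∈ bandHull L ↔ w ∈ (Set.pi univ fun _ : ι => Ioo (0 : ℝ) 1) ∧ ∀ i j, i ≠ j → w ∈ rectCyl L i j := by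
  simp only [bandHull, Set.mem_inter_iff, Set.mem_iInter, Finset.mem_filter, Finset.mem_univ, true_and]
  exact ⟨fun h => ⟨h.1, fun i j hij => h.2 (i, j) hij⟩, fun h => ⟨h.1, fun p hp => h.2 p.1 p.2 hp⟩⟩

/-- **The band hull of a sublattice is an open band inside the cube.** [this work] -/
theorem isOpenBand_bandHull {L : Set (ι → ℝ)} (hinf : ∀ x ∈ L, ∀ y ∈ L, x ⊓ y ∈ L)
    (hsup : ∀ x ∈ L, ∀ y ∈ L, x ⊔ y ∈ L) : IsOpenBand (bandHull L) :=
  isOpenBand_cube.biInter_finset _ fun _ hp => isOpenBand_rectCyl hinf hsup (Finset.mem_filter.1 hp).2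

/-- The band hull lies in the cube. [folklore] -/
theorem bandHull_subset (L : Set (ι → ℝ)) : bandHull L ⊆ Set.pi univ fun _ : ι => Ioo (0 : ℝ) 1 :=
  Set.inter_subset_left

/-! ### `L ⊆ᵐ bandHull L` -/

/-- **Points of `L` outside a rectangle cylinder have no point of `L` strictly upper-left, or none strictly
lower-right; both exceptional sets are null** (comonotone). [this work] -/
theorem volume_diff_rectCyl {L : Set (ι → ℝ)} (hLm : MeasurableSet L) {i j : ι} (hij : i ≠ j) :
    volume (L \ rectCyl L i j) = 0 := by
  set E₁ : Set (ι → ℝ) := L ∩ {z | ∃ x ∈ L, x i < z i ∧ z j < x j}ᶜ with hE₁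
  set E₂ : Set (ι → ℝ) := L ∩ {z | ∃ y ∈ L, z i < y i ∧ y j < z j}ᶜ with hE₂
  have ho₁ : IsOpen {z : ι → ℝ | ∃ x ∈ L, x i < z i ∧ z j < x j} := by
    have e : {z : ι → ℝ | ∃ x ∈ L, x i < z i ∧ z j < x j} = ⋃ x ∈ L, {z | x i < z i ∧ z j < x j} := by
      ext z; simp only [Set.mem_setOf_eq, Set.mem_iUnion, exists_prop]
    rw [e]
    exact isOpen_biUnion fun x _ =>
      (isOpen_lt continuous_const (continuous_apply i)).inter (isOpen_lt (continuous_apply j) continuous_const)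
  have ho₂ : IsOpen {z : ι → ℝ | ∃ y ∈ L, z i < y i ∧ y j < z j} := by
    have e : {z : ι → ℝ | ∃ y ∈ L, z i < y i ∧ y j < z j} = ⋃ y ∈ L, {z | z i < y i ∧ y j < z j} := by
      ext z; simp only [Set.mem_setOf_eq, Set.mem_iUnion, exists_prop]
    rw [e]
    exact isOpen_biUnion fun y _ =>
      (isOpen_lt (continuous_apply i) continuous_const).inter (isOpen_lt continuous_const (continuous_apply j))
  have h₁ : volume E₁ = 0 := by
    refine volume_eq_zero_of_comonotone hij (hLm.inter ho₁.measurableSet.compl) fun z hz z' hz' hlt => ?_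
    by_contra hgt
    exact hz'.2 ⟨z, hz.1, hlt, not_le.1 hgt⟩
  have h₂ : volume E₂ = 0 := by
    refine volume_eq_zero_of_comonotone hij (hLm.inter ho₂.measurableSet.compl) fun z hz z' hz' hlt => ?_
    by_contra hgt
    exact hz.2 ⟨z', hz'.1, hlt, not_le.1 hgt⟩
  refine measure_mono_null (fun z hz => ?_) (measure_union_null h₁ h₂)
  by_contra hn
  simp only [Set.mem_union, not_or, hE₁, hE₂, Set.mem_inter_iff, Set.mem_compl_iff, not_and, not_not] at hn
  obtain ⟨x, hx, hx1, hx2⟩ := hn.1 hz.1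
  obtain ⟨y, hy, hy1, hy2⟩ := hn.2 hz.1
  exact hz.2 ⟨x, hx, y, hy, hx1, hy1, hy2, hx2⟩

/-- **`L ⊆ᵐ bandHull L`** for a measurable subset of the cube. [this work] -/
theorem volume_diff_bandHull {L : Set (ι → ℝ)} (hLm : MeasurableSet L)
    (hLU : L ⊆ Set.pi univ fun _ : ι => Ioo (0 : ℝ) 1) : volume (L \ bandHull L) = 0 := by
  have hsub : L \ bandHull L ⊆ ⋃ p ∈ (Finset.univ.filter fun p : ι × ι => p.1 ≠ p.2), L \ rectCyl L p.1 p.2 := by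
    intro z hz
    have hz' : ¬(∀ i j, i ≠ j → z ∈ rectCyl L i j) := fun h => hz.2 (mem_bandHull.2 ⟨hLU hz.1, h⟩)
    push Not at hz'
    obtain ⟨i, j, hij, hn⟩ := hz'
    exact Set.mem_iUnion₂.2 ⟨(i, j), Finset.mem_filter.2 ⟨Finset.mem_univ _, hij⟩, hz.1, hn⟩
  refine measure_mono_null hsub ((measure_biUnion_null_iff (Finset.countable_toSet _)).2 fun p hp => ?_)
  exact volume_diff_rectCyl hLm (Finset.mem_filter.1 hp).2

/-! ### `bandHull L ⊆ᵐ L` for a full sublattice -/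

omit [Fintype ι] [DecidableEq ι] in
/-- **A point with both hyperplanes through `L` and the rectangle witnesses in `L` has a point of `L` with the same
`(i, j)`-coordinates** (four lattice operations: `(x ⊔ uⁱ) ⊓ (y ⊔ uʲ)`). [this work] -/
theorem exists_mem_eq_eq {L : Set (ι → ℝ)} (hinf : ∀ x ∈ L, ∀ y ∈ L, x ⊓ y ∈ L)
    (hsup : ∀ x ∈ L, ∀ y ∈ L, x ⊔ y ∈ L) {i j : ι} {w : ι → ℝ} (hw : w ∈ rectCyl L i j)
    {u v : ι → ℝ} (hu : u ∈ L) (hui : u i = w i) (hv : v ∈ L) (hvj : v j = w j) :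
    ∃ z ∈ L, z i = w i ∧ z j = w j := by
  obtain ⟨x, hx, y, hy, h1, h2, h3, h4⟩ := hw
  refine ⟨(x ⊔ u) ⊓ (y ⊔ v), hinf _ (hsup _ hx _ hu) _ (hsup _ hy _ hv), ?_, ?_⟩
  · simp only [Pi.inf_apply, Pi.sup_apply, hui]
    rw [max_eq_right h1.le, min_eq_left (h2.le.trans (le_max_left _ _))]
  · simp only [Pi.inf_apply, Pi.sup_apply, hvj]
    rw [max_eq_right h3.le, min_eq_right (h4.le.trans (le_max_left _ _))]

omit [DecidableEq ι] in
/-- **Two-decomposability of sublattices of `ℝ^ι`** (Topkis): a point all of whose coordinate PAIRS are realised by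
points of the sublattice `L` lies in `L`: `w = ⋁ᵢ ⋀_{j ≠ i} z^{ij}`.  Requires `|ι| ≥ 2`. [folklore] -/
theorem mem_of_pairs [Nontrivial ι] {L : Set (ι → ℝ)} (hinf : ∀ x ∈ L, ∀ y ∈ L, x ⊓ y ∈ L)
    (hsup : ∀ x ∈ L, ∀ y ∈ L, x ⊔ y ∈ L) {w : ι → ℝ}
    (h : ∀ i j, i ≠ j → ∃ z ∈ L, z i = w i ∧ z j = w j) : w ∈ L := by
  classical
  choose! z hz hzi hzj using h
  have hne : ∀ i : ι, (Finset.univ.erase i).Nonempty := fun i => by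
    obtain ⟨j, hj⟩ := exists_ne i
    exact ⟨j, Finset.mem_erase.2 ⟨hj, Finset.mem_univ j⟩⟩
  -- `vⁱ = ⋀_{j ≠ i} z^{ij} ∈ L`, `vⁱᵢ = wᵢ`, `vⁱ ≤ w`
  set v : ι → ι → ℝ := fun i => (Finset.univ.erase i).inf' (hne i) (z i) with hv
  have hvL : ∀ i, v i ∈ L := fun i =>
    Finset.inf'_mem L (fun x hx y hy => hinf x hx y hy) _ _ _ fun j hj => hz i j (Finset.mem_erase.1 hj).1.symm
  have hvi : ∀ i, v i i = w i := fun i => by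
    simp only [hv, Finset.inf'_apply]
    refine le_antisymm ?_ (Finset.le_inf' _ _ fun j hj => (hzi i j (Finset.mem_erase.1 hj).1.symm).ge)
    obtain ⟨j, hj⟩ := hne i
    exact (Finset.inf'_le _ hj).trans (hzi i j (Finset.mem_erase.1 hj).1.symm).le
  have hvle : ∀ i k, v i k ≤ w k := fun i k => by
    by_cases hki : k = i
    · rw [hki, hvi]
    · simp only [hv, Finset.inf'_apply]
      exact (Finset.inf'_le _ (Finset.mem_erase.2 ⟨hki, Finset.mem_univ k⟩)).trans (hzj i k (Ne.symm hki)).le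
  -- `w = ⋁ᵢ vⁱ`
  have hw : w = Finset.univ.sup' Finset.univ_nonempty v := by
    funext k
    simp only [Finset.sup'_apply]
    refine le_antisymm ?_ (Finset.sup'_le _ _ fun i _ => hvle i k)
    exact (hvi k).ge.trans (Finset.le_sup' (fun i => v i k) (Finset.mem_univ k))
  rw [hw]
  exact Finset.sup'_mem L (fun x hx y hy => hsup x hx y hy) _ _ _ fun i _ => hvL i

/-- **`bandHull L ⊆ᵐ L` for a full sublattice of the cube.** [this work] -/
theorem volume_bandHull_diff [Nontrivial ι] {L : Set (ι → ℝ)} (hinf : ∀ x ∈ L, ∀ y ∈ L, x ⊓ y ∈ L)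
    (hsup : ∀ x ∈ L, ∀ y ∈ L, x ⊔ y ∈ L)
    (hfull : ∀ i, ∀ᵐ s ∂(volume : Measure ℝ), s ∈ Ioo (0 : ℝ) 1 → ∃ z ∈ L, z i = s) :
    volume (bandHull L \ L) = 0 := by
  have hae : ∀ᵐ w ∂(volume : Measure (ι → ℝ)), ∀ i, w i ∈ Ioo (0 : ℝ) 1 → ∃ z ∈ L, z i = w i :=
    ae_all_iff.2 fun i => (SahiAESeparableTilt.quasiMeasurePreserving_eval (ι := ι) i).ae (hfull i)
  have h : ∀ᵐ w ∂(volume : Measure (ι → ℝ)), w ∉ bandHull L \ L := by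
    filter_upwards [hae] with w hw hwd
    obtain ⟨hwU, hwR⟩ := mem_bandHull.1 hwd.1
    refine hwd.2 (mem_of_pairs hinf hsup fun i j hij => ?_)
    obtain ⟨u, hu, hui⟩ := hw i (Set.mem_univ_pi.1 hwU i)
    obtain ⟨v, hv, hvj⟩ := hw j (Set.mem_univ_pi.1 hwU j)
    exact exists_mem_eq_eq hinf hsup (hwR i j hij) hu hui hv hvj
  rw [ae_iff] at h
  simpa only [not_not, Set.setOf_mem_eq] using h

/-! ### The support theorem -/

/-- **A full measurable sublattice of the open unit cube is almost everywhere an open band** (`|ι| ≥ 2`).  Fullness: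
in every direction, almost every hyperplane of the cube meets `L`. [this work] -/
theorem exists_isOpenBand_ae_eq [Nontrivial ι] {L : Set (ι → ℝ)} (hLm : MeasurableSet L)
    (hLU : L ⊆ Set.pi univ fun _ : ι => Ioo (0 : ℝ) 1)
    (hinf : ∀ x ∈ L, ∀ y ∈ L, x ⊓ y ∈ L) (hsup : ∀ x ∈ L, ∀ y ∈ L, x ⊔ y ∈ L)
    (hfull : ∀ i, ∀ᵐ s ∂(volume : Measure ℝ), s ∈ Ioo (0 : ℝ) 1 → ∃ z ∈ L, z i = s) :
    ∃ U : Set (ι → ℝ), IsOpenBand U ∧ U ⊆ Set.pi univ (fun _ : ι => Ioo (0 : ℝ) 1) ∧ U =ᵐ[volume] L :=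
  ⟨bandHull L, isOpenBand_bandHull hinf hsup, bandHull_subset L,
    (ae_eq_set (μ := (volume : Measure (ι → ℝ)))).2 ⟨volume_bandHull_diff hinf hsup hfull, volume_diff_bandHull hLm hLU⟩⟩

end Summit.CriticalPhenomena.PercolationContinuityZ3.Theorems.SahiAEFourFunctions
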